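import Summits.QuantumFields.QCD.Theorems.SpectralDefectExtinctionTipPricingAbstractTemplate
import Summits.QuantumFields.QCD.Theorems.SpectralDefectExtinctionTipPricingSchurGap

/-!
# Index of a tiled box: the abstract assembly (auxiliary to sub-goal ASM1 of crux stmt-QuantumFields-8967)

Pure linear algebra behind `boxBlock_index_of_cells` (file `…TipPricingBoxBlockIndex.lean`; sub-goal ASM1 of the modular
cell–wall template, crux `Summit.QuantumFields.QCD.Theses.SpectralDefectExtinction.TipPricing`, line `hermitian-flow-coarea`,
lead c2).  Given a Hermitian matrix `H` on an index type `ι`, a "big box" of indices `Bx → ι` that splits as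
(cell index `α` × cell label `o`) ⊕ (wall `Wl`), and for every label `k` a "cell with collar" `Cw k → ι` that splits as
`α ⊕ Co k` (cell ⊕ collar), the abstract modular template (`negRootCount_cellWall_template`), Haynsworth inertia additivity
(`negRootCount_fromBlocks_haynsworth`) and the Schur-complement gap (`norm_gap_schur_complement`) combine into the inertia
identity
`n₋(H_Bx) + Σ_k n₋(H_{Co k}) = n₋(H_Wl) + Σ_k n₋(H_{Cw k})`, `det H_Bx ≠ 0`
(`boxBlock_abstract_assembly`), provided: the wall and collar blocks are invertible, the cell-with-collar blocks have a norm
gap `g`, distinct cells and a cell and a foreign collar are not coupled by `H`, and the wall Schur correction differs from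
the sum of the per-collar corrections by a form of size `ε < g` (the output of `schur_lattice_locality`).
Also recorded: invariance of `negRootCount`, of the norm gap and of the Hermitian form under re-indexing by an
equivalence, and the independence of the gap/inertia/determinant package from the `Fintype`/`DecidableEq` instances used to
state it (needed to combine tree lemmas elaborated with classical and with constructive instances).
Supports stmt-QuantumFields-8967 (helper; closes no item).
-/

namespace Summit.QuantumFields.QCD.Cruxes.TipPricing.ModularTemplate

open Matrix
open Summit.QuantumFields.QCD.Theorems.ExtinctionBuildsQCD.Negative
open scoped BigOperators

/-! ### Re-indexing invariance -/

/-- `negRootCount` is invariant under re-indexing by an equivalence. -/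
theorem negRootCount_submatrix_equiv {α β : Type*} [Fintype α] [DecidableEq α] [Fintype β] [DecidableEq β]
    (σ : α ≃ β) (M : Matrix β β ℂ) : negRootCount (M.submatrix σ σ) = negRootCount M := by
  unfold negRootCount
  have h : (M.submatrix σ σ).charpoly = M.charpoly := Matrix.charpoly_reindex σ.symm M
  rw [h]

/-- A norm gap is invariant under re-indexing by an equivalence. -/
theorem normGap_submatrix_equiv {α β : Type*} [Fintype α] [Fintype β] (σ : α ≃ β) (M : Matrix β β ℂ) {g : ℝ}
    (h : ∀ v : β → ℂ, g ^ 2 * ∑ i, ‖v i‖ ^ 2 ≤ ∑ i, ‖(M *ᵥ v) i‖ ^ 2) (v : α → ℂ) :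
    g ^ 2 * ∑ i, ‖v i‖ ^ 2 ≤ ∑ i, ‖(M.submatrix σ σ *ᵥ v) i‖ ^ 2 := by
  have h1 : ∑ i, ‖v i‖ ^ 2 = ∑ j, ‖(v ∘ σ.symm) j‖ ^ 2 :=
    Fintype.sum_equiv σ _ _ fun i => by simp
  have h2 : ∑ i, ‖(M.submatrix σ σ *ᵥ v) i‖ ^ 2 = ∑ j, ‖(M *ᵥ (v ∘ σ.symm)) j‖ ^ 2 := by
    rw [submatrix_mulVec_equiv]
    exact Equiv.sum_comp σ (fun j => ‖(M *ᵥ (v ∘ σ.symm)) j‖ ^ 2)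
  rw [h1, h2]
  exact h _

/-- The Hermitian form is invariant under re-indexing by an equivalence. -/
theorem form_submatrix_equiv {α β : Type*} [Fintype α] [Fintype β] (σ : α ≃ β) (M : Matrix β β ℂ) (v : α → ℂ) :
    star v ⬝ᵥ (M.submatrix σ σ *ᵥ v) = star (v ∘ σ.symm) ⬝ᵥ (M *ᵥ (v ∘ σ.symm)) := by
  rw [submatrix_mulVec_equiv]
  unfold dotProduct
  rw [← Equiv.sum_comp σ (fun j => star (v ∘ σ.symm) j * (M *ᵥ (v ∘ σ.symm)) j)]
  exact Finset.sum_congr rfl fun i _ => by simp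

/-- A principal submatrix along `Sum.elim f g` is the block matrix of the four submatrices. -/
theorem submatrix_sum_elim {ι α β R : Type*} (M : Matrix ι ι R) (f : α → ι) (g : β → ι) :
    M.submatrix (Sum.elim f g) (Sum.elim f g) =
      Matrix.fromBlocks (M.submatrix f f) (M.submatrix f g) (M.submatrix g f) (M.submatrix g g) := by
  ext (i | i) (j | j) <;> rfl

/-- For a Hermitian matrix, the transposed off-diagonal block is the conjugate transpose. -/
theorem submatrix_swap_eq_conjTranspose {ι α β : Type*} {H : Matrix ι ι ℂ} (hH : H.IsHermitian) (f : α → ι)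
    (g : β → ι) : H.submatrix g f = (H.submatrix f g)ᴴ := by
  ext i a
  rw [conjTranspose_apply, submatrix_apply, submatrix_apply]
  exact (hH.apply _ _).symm

/-! ### Instance independence -/

/-- The package "norm gap `g`, exactly `6 · card γ` negative characteristic roots, invertible" does not depend on the
`Fintype` / `DecidableEq` instances used to state it. -/
theorem gapHalfDet_instIndep {β γ : Type*} {i₁ : Fintype β} {d₁ : DecidableEq β} {j₁ : Fintype γ}
    [i₂ : Fintype β] [d₂ : DecidableEq β] [j₂ : Fintype γ] (M : Matrix β β ℂ) (g : ℝ)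
    (h : letI := i₁; letI := d₁; letI := j₁;
      (∀ v : β → ℂ, g ^ 2 * ∑ i, ‖v i‖ ^ 2 ≤ ∑ i, ‖(M *ᵥ v) i‖ ^ 2) ∧
        negRootCount M = 6 * Fintype.card γ ∧ M.det ≠ 0) :
    (∀ v : β → ℂ, g ^ 2 * ∑ i, ‖v i‖ ^ 2 ≤ ∑ i, ‖(M *ᵥ v) i‖ ^ 2) ∧
      negRootCount M = 6 * Fintype.card γ ∧ M.det ≠ 0 := by
  obtain rfl : i₁ = i₂ := Subsingleton.elim _ _
  obtain rfl : d₁ = d₂ := Subsingleton.elim _ _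
  obtain rfl : j₁ = j₂ := Subsingleton.elim _ _
  exact h

/-! ### Vanishing entries of `X F Xᴴ` -/

/-- If row `a` of `X` vanishes then so does row `a` of `X F Xᴴ`. -/
theorem mul_mul_conjTranspose_apply_eq_zero_of_row {r c : Type*} [Fintype c] (X : Matrix r c ℂ) (F : Matrix c c ℂ)
    (a a' : r) (h : ∀ i, X a i = 0) : (X * F * Xᴴ) a a' = 0 := by
  simp only [mul_apply, conjTranspose_apply, h, zero_mul, Finset.sum_const_zero]

/-- If row `a'` of `X` vanishes then so does column `a'` of `X F Xᴴ`. -/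
theorem mul_mul_conjTranspose_apply_eq_zero_of_col {r c : Type*} [Fintype c] (X : Matrix r c ℂ) (F : Matrix c c ℂ)
    (a a' : r) (h : ∀ j, X a' j = 0) : (X * F * Xᴴ) a a' = 0 := by
  simp only [mul_apply, conjTranspose_apply, h, star_zero, mul_zero, Finset.sum_const_zero]

/-! ### One cell with collar: the dressed cell operator -/

/-- **The dressed cell operator.**  For a cell-with-collar block `H_Cw`, re-indexed by `ek` as (cell `gCk`) ⊕ (collar `fCo`),
with invertible collar block and norm gap `g`, the Schur complement `K = H_cell − H_{cell,collar} H_collar⁻¹ H_{collar,cell}`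
is Hermitian, has the norm gap `g` (`norm_gap_schur_complement`) and `n₋(H_Cw) = n₋(H_collar) + n₋(K)` (Haynsworth). -/
theorem cellSchur_facts {ι α Co Cw : Type*} [Fintype ι] [Fintype α] [DecidableEq α] [Fintype Co] [DecidableEq Co]
    [Fintype Cw] [DecidableEq Cw] (H : Matrix ι ι ℂ) (hH : H.IsHermitian) (gCk : α → ι) (fCo : Co → ι) (fCw : Cw → ι)
    (ek : Cw ≃ α ⊕ Co) (hek₁ : ∀ a, fCw (ek.symm (Sum.inl a)) = gCk a) (hek₂ : ∀ i, fCw (ek.symm (Sum.inr i)) = fCo i)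
    (hdet : (H.submatrix fCo fCo).det ≠ 0) {g : ℝ}
    (hgap : ∀ v : Cw → ℂ, g ^ 2 * ∑ i, ‖v i‖ ^ 2 ≤ ∑ i, ‖(H.submatrix fCw fCw *ᵥ v) i‖ ^ 2) :
    (H.submatrix gCk gCk - H.submatrix gCk fCo * (H.submatrix fCo fCo)⁻¹ * (H.submatrix gCk fCo)ᴴ).IsHermitian ∧
    (∀ v : α → ℂ, g ^ 2 * ∑ i, ‖v i‖ ^ 2 ≤
      ∑ i, ‖((H.submatrix gCk gCk - H.submatrix gCk fCo * (H.submatrix fCo fCo)⁻¹ * (H.submatrix gCk fCo)ᴴ) *ᵥ v) i‖ ^ 2) ∧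
    negRootCount (H.submatrix fCw fCw) = negRootCount (H.submatrix fCo fCo) +
      negRootCount (H.submatrix gCk gCk - H.submatrix gCk fCo * (H.submatrix fCo fCo)⁻¹ * (H.submatrix gCk fCo)ᴴ) := by
  have hfek : fCw ∘ ek.symm = Sum.elim gCk fCo := by
    funext x
    rcases x with a | i
    · exact hek₁ a
    · exact hek₂ i
  have hCk : (H.submatrix fCw fCw).submatrix ek.symm ek.symm =
      Matrix.fromBlocks (H.submatrix gCk gCk) (H.submatrix gCk fCo) (H.submatrix gCk fCo)ᴴ (H.submatrix fCo fCo) := by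
    rw [submatrix_submatrix, hfek, submatrix_sum_elim, submatrix_swap_eq_conjTranspose hH gCk fCo]
  have hHk : (H.submatrix gCk gCk).IsHermitian := hH.submatrix _
  have hFk : (H.submatrix fCo fCo).IsHermitian := hH.submatrix _
  refine ⟨hHk.sub (Matrix.isHermitian_mul_mul_conjTranspose _ hFk.inv), fun v => ?_, ?_⟩
  · refine norm_gap_schur_complement _ _ _ _ (isUnit_iff_ne_zero.2 hdet) ?_ v
    rw [← hCk]
    exact normGap_submatrix_equiv ek.symm _ hgap
  · rw [← negRootCount_submatrix_equiv ek.symm, hCk]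
    exact negRootCount_fromBlocks_haynsworth _ _ _ hHk hFk hdet

/-! ### The abstract assembly -/

/-- **Abstract assembly of the tiled-box index.**  `H` Hermitian on `ι`; big box `fB : Bx → ι` re-indexed by `e` as
(cells `gC : α × o → ι`) ⊕ (wall `fW`); each cell-with-collar `fCw k` re-indexed by `ek k` as (cell `k`) ⊕ (collar `fCo k`);
`σ` identifies `α × o` with the cell index type `Cl` of the locality estimate.  If distinct cells, and a cell and a foreign
collar, are not coupled by `H` (`hoff`, `hoffC`), the wall and collar blocks are invertible, every cell-with-collar block has
the norm gap `g`, and the wall Schur correction differs from the sum of the per-collar corrections by a form of size `ε < g`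
on the cells, then `det H_Bx ≠ 0` and `n₋(H_Bx) + Σ_k n₋(H_{Co k}) = n₋(H_Wl) + Σ_k n₋(H_{Cw k})`. [folklore] -/
theorem boxBlock_abstract_assembly {ι α o Bx Wl Cl : Type*} [Fintype ι] [DecidableEq ι] [Fintype α] [DecidableEq α]
    [Fintype o] [DecidableEq o] [Fintype Bx] [DecidableEq Bx] [Fintype Wl] [DecidableEq Wl] [Fintype Cl]
    [DecidableEq Cl] {Co Cw : o → Type*} [∀ k, Fintype (Co k)] [∀ k, DecidableEq (Co k)] [∀ k, Fintype (Cw k)]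
    [∀ k, DecidableEq (Cw k)]
    (H : Matrix ι ι ℂ) (hH : H.IsHermitian) (gC : α × o → ι) (fB : Bx → ι) (fW : Wl → ι) (fCl : Cl → ι)
    (fCo : ∀ k, Co k → ι) (fCw : ∀ k, Cw k → ι)
    (e : Bx ≃ (α × o) ⊕ Wl) (he₁ : ∀ q, fB (e.symm (Sum.inl q)) = gC q) (he₂ : ∀ w, fB (e.symm (Sum.inr w)) = fW w)
    (ek : ∀ k, Cw k ≃ α ⊕ Co k) (hek₁ : ∀ k a, fCw k ((ek k).symm (Sum.inl a)) = gC (a, k))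
    (hek₂ : ∀ k i, fCw k ((ek k).symm (Sum.inr i)) = fCo k i)
    (σ : α × o ≃ Cl) (hσ : ∀ q, fCl (σ q) = gC q)
    (hoff : ∀ q q' : α × o, q.2 ≠ q'.2 → H (gC q) (gC q') = 0)
    (hoffC : ∀ (q : α × o) (k : o) (i : Co k), q.2 ≠ k → H (gC q) (fCo k i) = 0)
    (hWdet : (H.submatrix fW fW).det ≠ 0) (hCodet : ∀ k, (H.submatrix (fCo k) (fCo k)).det ≠ 0)
    {g ε : ℝ} (hε : 0 ≤ ε) (hεg : ε < g)
    (hgap : ∀ (k : o) (v : Cw k → ℂ), g ^ 2 * ∑ i, ‖v i‖ ^ 2 ≤ ∑ i, ‖(H.submatrix (fCw k) (fCw k) *ᵥ v) i‖ ^ 2)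
    (hloc : ∀ v : Cl → ℂ,
      |(star v ⬝ᵥ ((H.submatrix fCl fW * (H.submatrix fW fW)⁻¹ * H.submatrix fW fCl -
          ∑ k, H.submatrix fCl (fCo k) * (H.submatrix (fCo k) (fCo k))⁻¹ * H.submatrix (fCo k) fCl) *ᵥ v)).re| ≤
        ε * ∑ i, ‖v i‖ ^ 2) :
    (H.submatrix fB fB).det ≠ 0 ∧
      negRootCount (H.submatrix fB fB) + ∑ k, negRootCount (H.submatrix (fCo k) (fCo k)) =
        negRootCount (H.submatrix fW fW) + ∑ k, negRootCount (H.submatrix (fCw k) (fCw k)) := by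
  ---- (1) the big block in `fromBlocks` form
  have hfe : fB ∘ e.symm = Sum.elim gC fW := by
    funext x
    rcases x with q | w
    · exact he₁ q
    · exact he₂ w
  have hA : (H.submatrix fB fB).submatrix e.symm e.symm =
      Matrix.fromBlocks (H.submatrix gC gC) (H.submatrix gC fW) (H.submatrix gC fW)ᴴ (H.submatrix fW fW) := by
    rw [submatrix_submatrix, hfe, submatrix_sum_elim, submatrix_swap_eq_conjTranspose hH gC fW]
  ---- (2) the dressed cell operators
  obtain ⟨K, hK⟩ : ∃ K : o → Matrix α α ℂ, ∀ k, K k =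
      H.submatrix (fun a => gC (a, k)) (fun a => gC (a, k)) -
        H.submatrix (fun a => gC (a, k)) (fCo k) * (H.submatrix (fCo k) (fCo k))⁻¹ *
          (H.submatrix (fun a => gC (a, k)) (fCo k))ᴴ := ⟨_, fun k => rfl⟩
  have hcell := fun k => cellSchur_facts H hH (fun a => gC (a, k)) (fCo k) (fCw k) (ek k) (hek₁ k) (hek₂ k) (hCodet k)
    (hgap k)
  have hKh : ∀ k, (K k).IsHermitian := fun k => by rw [hK k]; exact (hcell k).1
  have hgapK : ∀ (k : o) (v : α → ℂ), g ^ 2 * ∑ i, ‖v i‖ ^ 2 ≤ ∑ i, ‖(K k *ᵥ v) i‖ ^ 2 := fun k v => by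
    rw [hK k]; exact (hcell k).2.1 v
  have hcountK : ∀ k, negRootCount (H.submatrix (fCw k) (fCw k)) =
      negRootCount (H.submatrix (fCo k) (fCo k)) + negRootCount (K k) := fun k => by
    rw [hK k]; exact (hcell k).2.2
  ---- (3) the cell block is block diagonal
  have hHcdiag : H.submatrix gC gC = blockDiagonal fun k => H.submatrix (fun a => gC (a, k)) (fun a => gC (a, k)) := by
    ext ⟨a, k⟩ ⟨a', k'⟩
    rw [blockDiagonal_apply']
    by_cases hk : k = k'
    · subst hk
      rw [if_pos rfl]
      rfl
    · rw [if_neg hk]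
      exact hoff (a, k) (a', k') hk
  ---- (4) the error matrix is the re-indexed locality matrix
  obtain ⟨G, hG⟩ : ∃ G : o → Matrix α α ℂ, ∀ k, G k =
      H.submatrix (fun a => gC (a, k)) (fCo k) * (H.submatrix (fCo k) (fCo k))⁻¹ *
        (H.submatrix (fun a => gC (a, k)) (fCo k))ᴴ := ⟨_, fun k => rfl⟩
  have hσf : fCl ∘ σ = gC := funext hσ
  have hsumG : ∑ k, H.submatrix gC (fCo k) * (H.submatrix (fCo k) (fCo k))⁻¹ * (H.submatrix gC (fCo k))ᴴ =
      blockDiagonal G := by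
    ext ⟨a, k₁⟩ ⟨a', k₂⟩
    rw [Matrix.sum_apply, blockDiagonal_apply']
    have hrow : ∀ k, k₁ ≠ k →
        (H.submatrix gC (fCo k) * (H.submatrix (fCo k) (fCo k))⁻¹ * (H.submatrix gC (fCo k))ᴴ) (a, k₁) (a', k₂) = 0 :=
      fun k hk => mul_mul_conjTranspose_apply_eq_zero_of_row _ _ _ _ fun i => hoffC (a, k₁) k i hk
    have hcol : ∀ k, k₂ ≠ k →
        (H.submatrix gC (fCo k) * (H.submatrix (fCo k) (fCo k))⁻¹ * (H.submatrix gC (fCo k))ᴴ) (a, k₁) (a', k₂) = 0 :=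
      fun k hk => mul_mul_conjTranspose_apply_eq_zero_of_col _ _ _ _ fun j => hoffC (a', k₂) k j hk
    by_cases hk : k₁ = k₂
    · subst hk
      rw [if_pos rfl, Finset.sum_eq_single k₁ (fun k _ hk => hrow k (Ne.symm hk))
        (fun h => absurd (Finset.mem_univ _) h), hG k₁]
      rfl
    · rw [if_neg hk]
      refine Finset.sum_eq_zero fun k _ => ?_
      by_cases hk₁ : k₁ = k
      · subst hk₁
        exact hcol k₁ (Ne.symm hk)
      · exact hrow k hk₁
  have hMσ : (H.submatrix fCl fW * (H.submatrix fW fW)⁻¹ * H.submatrix fW fCl -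
      ∑ k, H.submatrix fCl (fCo k) * (H.submatrix (fCo k) (fCo k))⁻¹ * H.submatrix (fCo k) fCl).submatrix σ σ =
      H.submatrix gC fW * (H.submatrix fW fW)⁻¹ * (H.submatrix gC fW)ᴴ - blockDiagonal G := by
    have h1 : (H.submatrix fCl fW * (H.submatrix fW fW)⁻¹ * H.submatrix fW fCl).submatrix σ σ =
        H.submatrix gC fW * (H.submatrix fW fW)⁻¹ * (H.submatrix gC fW)ᴴ := by
      rw [submatrix_mul _ _ σ _root_.id σ Function.bijective_id,
        submatrix_mul _ _ σ _root_.id _root_.id Function.bijective_id, submatrix_submatrix, submatrix_submatrix,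
        submatrix_id_id, hσf, ← submatrix_swap_eq_conjTranspose hH gC fW]
      rfl
    have h2 : ∀ k, (H.submatrix fCl (fCo k) * (H.submatrix (fCo k) (fCo k))⁻¹ * H.submatrix (fCo k) fCl).submatrix σ σ =
        H.submatrix gC (fCo k) * (H.submatrix (fCo k) (fCo k))⁻¹ * (H.submatrix gC (fCo k))ᴴ := by
      intro k
      rw [submatrix_mul _ _ σ _root_.id σ Function.bijective_id,
        submatrix_mul _ _ σ _root_.id _root_.id Function.bijective_id, submatrix_submatrix, submatrix_submatrix,
        submatrix_id_id, hσf, ← submatrix_swap_eq_conjTranspose hH gC (fCo k)]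
      rfl
    have h3 : (∑ k, H.submatrix fCl (fCo k) * (H.submatrix (fCo k) (fCo k))⁻¹ * H.submatrix (fCo k) fCl).submatrix σ σ =
        ∑ k, (H.submatrix fCl (fCo k) * (H.submatrix (fCo k) (fCo k))⁻¹ * H.submatrix (fCo k) fCl).submatrix σ σ := by
      ext q q'
      simp only [submatrix_apply, Matrix.sum_apply]
    rw [submatrix_sub, Pi.sub_apply, Pi.sub_apply, h1, h3, Finset.sum_congr rfl fun k _ => h2 k, hsumG]
  have hKsplit : blockDiagonal K =
      (blockDiagonal fun k => H.submatrix (fun a => gC (a, k)) (fun a => gC (a, k))) - blockDiagonal G := by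
    rw [← blockDiagonal_sub]
    congr 1
    funext k
    rw [Pi.sub_apply, hK k, hG k]
  have hErr : (H.submatrix gC gC - H.submatrix gC fW * (H.submatrix fW fW)⁻¹ * (H.submatrix gC fW)ᴴ) - blockDiagonal K =
      -((H.submatrix fCl fW * (H.submatrix fW fW)⁻¹ * H.submatrix fW fCl -
        ∑ k, H.submatrix fCl (fCo k) * (H.submatrix (fCo k) (fCo k))⁻¹ * H.submatrix (fCo k) fCl).submatrix σ σ) := by
    rw [hMσ, hKsplit, hHcdiag]
    abel
  ---- (5) the sub-gap error bound on `α × o`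
  have hE : ∀ v : α × o → ℂ,
      |(star v ⬝ᵥ ((H.submatrix gC gC - H.submatrix gC fW * (H.submatrix fW fW)⁻¹ * (H.submatrix gC fW)ᴴ) -
        blockDiagonal K) *ᵥ v).re| ≤ ε * ∑ x, ‖v x‖ ^ 2 := by
    intro v
    rw [hErr, neg_mulVec, dotProduct_neg, Complex.neg_re, abs_neg, form_submatrix_equiv]
    have h1 : ∑ x, ‖v x‖ ^ 2 = ∑ j, ‖(v ∘ σ.symm) j‖ ^ 2 := Fintype.sum_equiv σ _ _ fun i => by simp
    rw [h1]
    exact hloc _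
  ---- (6) the abstract template
  obtain ⟨hcount, hdet⟩ := negRootCount_cellWall_template (H.submatrix gC gC) (H.submatrix gC fW) (H.submatrix fW fW)
    (hH.submatrix gC) (hH.submatrix fW) hWdet K hKh hε hεg hgapK hE
  rw [← hA, negRootCount_submatrix_equiv] at hcount
  rw [← hA, det_submatrix_equiv_self] at hdet
  refine ⟨hdet, ?_⟩
  rw [hcount, add_assoc, ← Finset.sum_add_distrib]
  congr 1
  exact Finset.sum_congr rfl fun k _ => by rw [hcountK k, add_comm]

end Summit.QuantumFields.QCD.Cruxes.TipPricing.ModularTemplate
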